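import Mathlib.Analysis.SpecialFunctions.Trigonometric.Cotangent
import Mathlib.NumberTheory.ModularForms.EisensteinSeries.Summable
import Mathlib.Analysis.SpecialFunctions.Complex.Arg
import Mathlib.Analysis.Calculus.Deriv.CompMul
import HarnessLib

/-!
# The zeros of an Euler factor `1 − c N^{-s}` (`|c| = 1`): partial fractions for the higher
# logarithmic derivatives, and the sum `Σ_ω |s − ω|^{-2}`

Topic `Literature/NumberTheory/LFunctions`, namespace `Literature.NumberTheory.LFunctions`.  Everything here is
PROVED (one definition with body, `eulerNode`, and theorems).

For an integer `N ≥ 2` and a unimodular `c ∈ ℂ` the entire function `h(s) = 1 − c N^{-s}` — a single Euler factor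
of an imprimitive Hecke (or Dirichlet) `L`-function at a prime `𝔭 ∣ 𝔪`, `𝔭 ∤ 𝔣_χ`, `N = N𝔭`, `c = χ(𝔭)` — has the
purely imaginary zeros `ω_n = i(arg c + 2πn)/log N`, `n ∈ ℤ` (`eulerNode`).  We prove

* `hasSum_iteratedDeriv_logDeriv_eulerFactor` — **the partial-fraction expansion of the higher logarithmic
  derivatives**: for `Re s > 0` and `k ≥ 1`,
  `((−1)^k/k!) (h'/h)^{(k)}(s) = Σ_{n ∈ ℤ} (s − ω_n)^{−(k+1)}`
  — the contribution of the "trivial zeros of the Euler factors" to the explicit formula for the higher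
  derivatives of `−L'/L(s, χ)` of a NOT NECESSARILY PRIMITIVE Hecke character [cite: ThornerZaman2017, Lemma 2.2]
  ("the second sum is over all zeros `ω` of `L(s,χ)`, including trivial ones").  Proof: `h'/h(s) =
  (iλ/2π) · π cot(π x) − λ/2` with `λ = log N`, `x = (iλ s + arg c)/2π` in the upper half-plane, and Mathlib's
  Mittag-Leffler expansion `(π cot π x)^{(k)} = (−1)^k k! Σ_{n∈ℤ} (x + n)^{−(k+1)}`
  (`iteratedDerivWithin_cot_pi_mul_eq_mul_tsum_div_pow`);
* `tsum_norm_inv_sq_sub_eulerNode_le` — **the sum over these zeros**: for `σ = Re s > 0`,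
  `Σ_{n ∈ ℤ} |s − ω_n|^{−2} ≤ 2/σ² + (log N)/σ` [cite: ThornerZaman2017, Lemma 7.3] (there:
  `Σ ≤ (1/2σ + 2/(σ² log 2)) log N𝔮` summed over `𝔭 ∣ 𝔮`; the zeros are spaced by `2π/log N` on the line `Re = 0`).

These feed the node families of the Deuring–Heilbronn power-sum argument for the `L`-functions of a
congruence class group `mod 𝔪` (the four `L`-functions there are taken imprimitive `mod 𝔪`, so that the
non-negativity of the Dirichlet coefficients is termwise).

## References
* [ThornerZaman2017] J. Thorner, A. Zaman, *An explicit bound for the least prime ideal in the Chebotarev density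
  theorem*, Algebra Number Theory 11 (2017), Lemma 2.2 and Lemma 7.3.
-/

noncomputable section

open Complex Filter Set Real
open scoped Topology

namespace Literature.NumberTheory.LFunctions

/-! ### The zeros `ω_n = i (arg c + 2πn)/log N` -/

/-- The `n`-th zero `ω_n = i(arg c + 2πn)/log N` of the Euler factor `1 − c N^{-s}` (`|c| = 1`).
[cite: ThornerZaman2017, Lemma 7.3] -/
def eulerNode (N : ℕ) (c : ℂ) (n : ℤ) : ℂ := (((Complex.arg c + 2 * π * n) / Real.log N : ℝ) : ℂ) * I

/-- The zeros of an Euler factor are purely imaginary. [cite: ThornerZaman2017, Lemma 7.3] -/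
theorem eulerNode_re (N : ℕ) (c : ℂ) (n : ℤ) : (eulerNode N c n).re = 0 := by
  rw [eulerNode, Complex.re_ofReal_mul, Complex.I_re, mul_zero]

/-- The imaginary part of `ω_n`. [cite: ThornerZaman2017, Lemma 7.3] -/
theorem eulerNode_im (N : ℕ) (c : ℂ) (n : ℤ) :
    (eulerNode N c n).im = (Complex.arg c + 2 * π * n) / Real.log N := by
  rw [eulerNode, Complex.im_ofReal_mul, Complex.I_im, mul_one]

section factor

variable {N : ℕ} {c : ℂ}

/-- `log N > 0` for `N ≥ 2`. [folklore] -/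
private theorem log_pos_of_two_le (hN : 2 ≤ N) : 0 < Real.log (N : ℝ) :=
  Real.log_pos (by exact_mod_cast hN)

/-- The scaling constant `a = i log N / 2π`. [folklore] -/
private def scal (N : ℕ) : ℂ := I * (Real.log (N : ℝ) : ℂ) / (2 * π)

/-- The shift `b = arg c / 2π`. [folklore] -/
private def shift (c : ℂ) : ℂ := ((Complex.arg c / (2 * π) : ℝ) : ℂ)

/-- `a ≠ 0`. [folklore] -/
private theorem scal_ne_zero (hN : 2 ≤ N) : scal N ≠ 0 := by
  have hl : (Real.log (N : ℝ) : ℂ) ≠ 0 := Complex.ofReal_ne_zero.mpr (log_pos_of_two_le hN).ne'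
  have hπ : (2 * (π : ℂ)) ≠ 0 := mul_ne_zero two_ne_zero (Complex.ofReal_ne_zero.mpr Real.pi_ne_zero)
  unfold scal
  exact div_ne_zero (mul_ne_zero I_ne_zero hl) hπ

/-- `2πi (a s + b) = −(log N) s + i arg c`. [folklore] -/
private theorem two_pi_I_mul_affine (s : ℂ) :
    2 * π * I * (scal N * s + shift c) = -(Real.log (N : ℝ) : ℂ) * s + Complex.arg c * I := by
  have hπ : (2 * (π : ℂ)) ≠ 0 := mul_ne_zero two_ne_zero (Complex.ofReal_ne_zero.mpr Real.pi_ne_zero)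
  have h2π : (2 * (π : ℂ)) / (2 * π) = 1 := div_self hπ
  unfold scal shift
  push_cast
  calc 2 * (π : ℂ) * I * (I * Complex.log (N : ℂ) / (2 * π) * s + Complex.arg c / (2 * π))
      = (2 * (π : ℂ)) / (2 * π) * (I * I * Complex.log (N : ℂ) * s + Complex.arg c * I) := by ring
    _ = -Complex.log (N : ℂ) * s + Complex.arg c * I := by rw [h2π, I_mul_I]; ring

/-- For `N ≥ 1` and `|c| = 1`: `c N^{-s} = exp(2πi(a s + b))`. [folklore] -/
private theorem mul_cpow_eq_exp (hN : 2 ≤ N) (hc : ‖c‖ = 1) (s : ℂ) :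
    c * ((N : ℕ) : ℂ) ^ (-s) = Complex.exp (2 * π * I * (scal N * s + shift c)) := by
  have hN0 : ((N : ℕ) : ℂ) ≠ 0 := by exact_mod_cast (show N ≠ 0 by omega)
  have hc' : c = Complex.exp (Complex.arg c * I) := by
    have := Complex.norm_mul_exp_arg_mul_I c
    rw [hc, Complex.ofReal_one, one_mul] at this
    exact this.symm
  rw [two_pi_I_mul_affine, Complex.exp_add, Complex.cpow_def_of_ne_zero hN0,
    show Complex.log ((N : ℕ) : ℂ) = (Real.log (N : ℝ) : ℂ) from (Complex.natCast_log).symm,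
    show (Real.log (N : ℝ) : ℂ) * -s = -(Real.log (N : ℝ) : ℂ) * s by ring, ← hc', mul_comm]

/-- `|c N^{-s}| = N^{-Re s} < 1` for `Re s > 0`. [cite: ThornerZaman2017, Lemma 7.3] -/
theorem norm_mul_cpow_lt_one (hN : 2 ≤ N) (hc : ‖c‖ = 1) {s : ℂ} (hs : 0 < s.re) :
    ‖c * ((N : ℕ) : ℂ) ^ (-s)‖ < 1 := by
  have hNpos : 0 < N := by omega
  rw [norm_mul, hc, one_mul, Complex.norm_natCast_cpow_of_pos hNpos, Complex.neg_re]
  exact Real.rpow_lt_one_of_one_lt_of_neg (by exact_mod_cast hN) (by linarith)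

/-- The Euler factor does not vanish on `Re s > 0` (its zeros are purely imaginary).
[cite: ThornerZaman2017, Lemma 7.3] -/
theorem eulerFactor_ne_zero (hN : 2 ≤ N) (hc : ‖c‖ = 1) {s : ℂ} (hs : 0 < s.re) :
    1 - c * ((N : ℕ) : ℂ) ^ (-s) ≠ 0 := by
  intro h
  have h1 : c * ((N : ℕ) : ℂ) ^ (-s) = 1 := by linear_combination -h
  have := norm_mul_cpow_lt_one hN hc hs
  rw [h1, norm_one] at this
  exact lt_irrefl _ this

/-- The derivative of the Euler factor: `h'(s) = c log N · N^{-s}`. [cite: ThornerZaman2017, Lemma 7.2] -/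
theorem hasDerivAt_eulerFactor (hN : 2 ≤ N) (c s : ℂ) :
    HasDerivAt (fun z : ℂ ↦ 1 - c * ((N : ℕ) : ℂ) ^ (-z))
      (c * ((Real.log (N : ℝ) : ℂ) * ((N : ℕ) : ℂ) ^ (-s))) s := by
  have hN0 : ((N : ℕ) : ℂ) ≠ 0 := by exact_mod_cast (show N ≠ 0 by omega)
  have h1 : HasDerivAt (fun z : ℂ ↦ ((N : ℕ) : ℂ) ^ (-z))
      (((N : ℕ) : ℂ) ^ (-s) * Complex.log ((N : ℕ) : ℂ) * (-1)) s := by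
    simpa using ((hasDerivAt_neg s).const_cpow (c := ((N : ℕ) : ℂ)) (Or.inl hN0))
  have h2 := (h1.const_mul c).const_sub 1
  refine h2.congr_deriv ?_
  rw [show Complex.log ((N : ℕ) : ℂ) = (Real.log (N : ℝ) : ℂ) from (Complex.natCast_log).symm]
  ring

/-- **The logarithmic derivative of an Euler factor**:
`h'/h(s) = log N · q/(1 − q)`, `q = c N^{-s}` (TZ: `P'/P(s,χ) = Σ_𝔭 Σ_k χ*(𝔭^k) log N𝔭^k/(k N𝔭^{ks})`).
[cite: ThornerZaman2017, Lemma 7.2] -/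
theorem logDeriv_eulerFactor (hN : 2 ≤ N) (c s : ℂ) :
    logDeriv (fun z : ℂ ↦ 1 - c * ((N : ℕ) : ℂ) ^ (-z)) s =
      (Real.log (N : ℝ) : ℂ) * (c * ((N : ℕ) : ℂ) ^ (-s)) / (1 - c * ((N : ℕ) : ℂ) ^ (-s)) := by
  rw [logDeriv_apply, (hasDerivAt_eulerFactor hN c s).deriv]
  ring

/-- `a s + b` lies in the upper half-plane for `Re s > 0` (`Im = (log N) Re s / 2π`). [folklore] -/
private theorem affine_mem_upperHalfPlane (hN : 2 ≤ N) {s : ℂ} (hs : 0 < s.re) :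
    scal N * s + shift c ∈ UpperHalfPlane.upperHalfPlaneSet := by
  have hl := log_pos_of_two_le hN
  show 0 < (scal N * s + shift c).im
  have : (scal N * s + shift c).im = Real.log (N : ℝ) / (2 * π) * s.re := by
    have h1 : scal N * s = ((Real.log (N : ℝ) / (2 * π) : ℝ) : ℂ) * (I * s) := by
      unfold scal; push_cast; ring
    rw [h1, shift, Complex.add_im, Complex.im_ofReal_mul, Complex.I_mul_im, Complex.ofReal_im, add_zero]
  rw [this]
  positivity

/-- **The logarithmic derivative as a cotangent**: for `Re s > 0`,
`h'/h(s) = −(log N)/2 + a · π cot(π (a s + b))`, `a = i log N/2π`, `b = arg c/2π`. [folklore] -/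
private theorem logDeriv_eulerFactor_eq_cot (hN : 2 ≤ N) (hc : ‖c‖ = 1) {s : ℂ} (hs : 0 < s.re) :
    logDeriv (fun z : ℂ ↦ 1 - c * ((N : ℕ) : ℂ) ^ (-z)) s =
      -((Real.log (N : ℝ) : ℂ) / 2) +
        scal N * ((π : ℂ) * Complex.cot ((π : ℂ) * (scal N * s + shift c))) := by
  set q : ℂ := c * ((N : ℕ) : ℂ) ^ (-s) with hq
  have hq1 : 1 - q ≠ 0 := eulerFactor_ne_zero hN hc hs
  have hqexp : Complex.exp (2 * π * I * (scal N * s + shift c)) = q := (mul_cpow_eq_exp hN hc s).symm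
  rw [logDeriv_eulerFactor hN c s, Complex.cot_pi_eq_exp_ratio, hqexp, ← hq]
  have hπ : (π : ℂ) ≠ 0 := Complex.ofReal_ne_zero.mpr Real.pi_ne_zero
  unfold scal
  field_simp
  ring

/-- **Scaling under the iterated derivative** (no differentiability hypothesis, the junk values match):
`(f(a ·))^{(k)}(x) = a^k f^{(k)}(a x)`. [folklore] -/
private theorem iteratedDeriv_comp_mul_left (f : ℂ → ℂ) (a : ℂ) (k : ℕ) :
    iteratedDeriv k (fun x ↦ f (a * x)) = fun x ↦ a ^ k * iteratedDeriv k f (a * x) := by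
  induction k with
  | zero => funext x; simp
  | succ k ih =>
    funext x
    rw [iteratedDeriv_succ, ih, deriv_const_mul_field']
    simp only []
    rw [deriv_comp_mul_left a (iteratedDeriv k f) x, iteratedDeriv_succ, smul_eq_mul]
    ring

/-- `Σ_{n ∈ ℤ} (z + n)^{−(k+1)}` converges absolutely for `k ≥ 1`. [folklore] -/
private theorem summable_one_div_add_int_pow (z : ℂ) {k : ℕ} (hk : 1 ≤ k) :
    Summable fun n : ℤ ↦ 1 / (z + n) ^ (k + 1) := by
  have h := EisensteinSeries.linear_right_summable z 1 (k := ((k + 1 : ℕ) : ℤ)) (by omega)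
  refine h.congr fun n ↦ ?_
  simp only [Int.cast_one, one_mul, zpow_natCast, one_div]

/-- The affine substitution on the nodes: `(a s + b) + n = a (s − ω_n)`. [folklore] -/
private theorem affine_add_int_eq (hN : 2 ≤ N) (s : ℂ) (n : ℤ) :
    scal N * s + shift c + n = scal N * (s - eulerNode N c n) := by
  have hl : Complex.log (N : ℂ) ≠ 0 := by
    rw [← Complex.natCast_log]; exact Complex.ofReal_ne_zero.mpr (log_pos_of_two_le hN).ne'
  have hπ : (2 * (π : ℂ)) ≠ 0 := mul_ne_zero two_ne_zero (Complex.ofReal_ne_zero.mpr Real.pi_ne_zero)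
  have key : scal N * eulerNode N c n = -(shift c + n) := by
    unfold scal shift eulerNode
    push_cast
    calc I * Complex.log (N : ℂ) / (2 * π) * ((Complex.arg c + 2 * π * n) / Complex.log (N : ℂ) * I)
        = (I * I) * (Complex.log (N : ℂ) / Complex.log (N : ℂ)) *
            ((Complex.arg c + 2 * π * n) / (2 * π)) := by ring
      _ = -(Complex.arg c / (2 * π) + n) := by
          rw [I_mul_I, div_self hl]
          field_simp
  rw [mul_sub, key]
  ring

/-- **Partial fractions for the higher logarithmic derivatives of an Euler factor** (the trivial zeros
of the Euler factors in the explicit formula): for `N ≥ 2`, `|c| = 1`, `Re s > 0` and `k ≥ 1`,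
`((−1)^k/k!) · (h'/h)^{(k)}(s) = Σ_{n ∈ ℤ} (s − ω_n)^{−(k+1)}` where `h(s) = 1 − cN^{-s}`,
`ω_n = i(arg c + 2πn)/log N`. [cite: ThornerZaman2017, Lemma 2.2] -/
theorem hasSum_iteratedDeriv_logDeriv_eulerFactor (hN : 2 ≤ N) (hc : ‖c‖ = 1) {s : ℂ} (hs : 0 < s.re)
    {k : ℕ} (hk : 1 ≤ k) :
    HasSum (fun n : ℤ ↦ ((s - eulerNode N c n) ^ (k + 1))⁻¹)
      ((-1) ^ k / (k.factorial : ℂ) *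
        iteratedDeriv k (logDeriv (fun z : ℂ ↦ 1 - c * ((N : ℕ) : ℂ) ^ (-z))) s) := by
  set a : ℂ := scal N with ha
  set b : ℂ := shift c with hb
  set F : ℂ → ℂ := fun x ↦ (π : ℂ) * Complex.cot ((π : ℂ) * x) with hF
  have ha0 : a ≠ 0 := scal_ne_zero hN
  -- Step 1: `h'/h = −λ/2 + a F(a · + b)` near `s`
  have hU : IsOpen {z : ℂ | 0 < z.re} := isOpen_lt continuous_const Complex.continuous_re
  have hev : logDeriv (fun z : ℂ ↦ 1 - c * ((N : ℕ) : ℂ) ^ (-z)) =ᶠ[𝓝 s]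
      fun z ↦ -((Real.log (N : ℝ) : ℂ) / 2) + a * F (a * z + b) := by
    filter_upwards [hU.mem_nhds hs] with z hz
    exact logDeriv_eulerFactor_eq_cot hN hc hz
  rw [hev.iteratedDeriv_eq, iteratedDeriv_const_add hk]
  -- Step 2: `F(a · + b)` is smooth at `s`
  have hxs : a * s + b ∈ UpperHalfPlane.upperHalfPlaneSet := affine_mem_upperHalfPlane hN hs
  have hFx : ContDiffAt ℂ k F (a * s + b) := by
    have h1 : ContDiffWithinAt ℂ k (fun x : ℂ ↦ Complex.cot ((π : ℂ) * x))
        UpperHalfPlane.upperHalfPlaneSet (a * s + b) :=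
      cot_pi_mul_contDiffWithinAt k (UpperHalfPlane.coe_mem_integerComplement ⟨a * s + b, hxs⟩)
    have h2 : ContDiffAt ℂ k (fun x : ℂ ↦ Complex.cot ((π : ℂ) * x)) (a * s + b) :=
      h1.contDiffAt (UpperHalfPlane.isOpen_upperHalfPlaneSet.mem_nhds hxs)
    exact contDiffAt_const.mul h2
  have hlin : ContDiffAt ℂ k (fun z : ℂ ↦ a * z + b) s := by fun_prop
  have hcomp : ContDiffAt ℂ k (fun z : ℂ ↦ F (a * z + b)) s :=
    ContDiffAt.comp (g := F) (f := fun z : ℂ ↦ a * z + b) s hFx hlin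
  rw [iteratedDeriv_const_mul _ hcomp]
  -- Step 3: the affine change of variables
  have hshift : (fun z : ℂ ↦ F (a * z + b)) = fun z ↦ (fun u ↦ F (u + b)) (a * z) := rfl
  rw [hshift, iteratedDeriv_comp_mul_left (fun u ↦ F (u + b)) a k]
  simp only []
  rw [iteratedDeriv_comp_add_const k F b]
  simp only []
  -- Step 4: Mathlib's cotangent expansion on the upper half-plane
  have hcot := iteratedDerivWithin_cot_pi_mul_eq_mul_tsum_div_pow hk hxs
  rw [UpperHalfPlane.isOpen_upperHalfPlaneSet |> iteratedDerivWithin_of_isOpen <| hxs] at hcot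
  rw [show (fun x : ℂ ↦ (π : ℂ) * Complex.cot ((π : ℂ) * x)) = F from rfl] at hcot
  rw [hcot]
  -- Step 5: the series, term by term
  have hsum := (summable_one_div_add_int_pow (a * s + b) hk).hasSum
  have hterm : ∀ n : ℤ, 1 / (a * s + b + n) ^ (k + 1) = (a ^ (k + 1))⁻¹ * ((s - eulerNode N c n) ^ (k + 1))⁻¹ := by
    intro n
    rw [affine_add_int_eq hN s n, mul_pow, one_div, mul_inv]
  have hsum' : HasSum (fun n : ℤ ↦ ((s - eulerNode N c n) ^ (k + 1))⁻¹)
      (a ^ (k + 1) * ∑' n : ℤ, 1 / (a * s + b + n) ^ (k + 1)) := by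
    have := hsum.mul_left (a ^ (k + 1))
    refine this.congr_fun fun n ↦ ?_
    rw [hterm, ← mul_assoc, mul_inv_cancel₀ (pow_ne_zero _ ha0), one_mul]
  convert hsum' using 1
  have hfac : (k.factorial : ℂ) ≠ 0 := by exact_mod_cast k.factorial_ne_zero
  have hε : ((-1 : ℂ) ^ k) * (-1) ^ k = 1 := by rw [← mul_pow]; simp
  field_simp
  linear_combination (a * a ^ k * ∑' n : ℤ, 1 / (a * s + b + n) ^ (k + 1)) * hε

end factor

/-! ### The sum `Σ_n |s − ω_n|^{−2}` -/

section sum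

variable {N : ℕ} {c : ℂ}

/-- `|s − ω_n|² = σ² + (t − Im ω_n)²`. [cite: ThornerZaman2017, Lemma 7.3] -/
theorem norm_sq_sub_eulerNode (s : ℂ) (n : ℤ) :
    ‖s - eulerNode N c n‖ ^ 2 = s.re ^ 2 + (s.im - (eulerNode N c n).im) ^ 2 := by
  rw [Complex.sq_norm, Complex.normSq_apply, Complex.sub_re, Complex.sub_im, eulerNode_re, sub_zero]
  ring

/-- The comparison series `Σ_{j ≥ 0} (σ² + h²j²)^{−1} ≤ σ^{−2} + 2/(hσ)` (telescoping against
`2/((σ + h(j−1))(σ + hj))`). [folklore] -/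
private theorem sum_range_inv_sq_add_le {σ h : ℝ} (hσ : 0 < σ) (hh : 0 < h) (n : ℕ) :
    ∑ j ∈ Finset.range n, (σ ^ 2 + h ^ 2 * (j : ℝ) ^ 2)⁻¹ ≤ (σ ^ 2)⁻¹ + 2 / (h * σ) := by
  -- `Σ_{j < m+1} ≤ σ^{-2} + (2/h)(1/σ − 1/(σ + h m))`
  have key : ∀ m : ℕ, ∑ j ∈ Finset.range (m + 1), (σ ^ 2 + h ^ 2 * (j : ℝ) ^ 2)⁻¹ ≤
      (σ ^ 2)⁻¹ + 2 / h * (σ⁻¹ - (σ + h * m)⁻¹) := by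
    intro m
    induction m with
    | zero => simp
    | succ m ih =>
      rw [Finset.sum_range_succ]
      have hm0 : (0 : ℝ) ≤ m := Nat.cast_nonneg m
      have hA : 0 < σ + h * m := by positivity
      have hB : 0 < σ + h * (m + 1 : ℕ) := by positivity
      have hF : (σ ^ 2 + h ^ 2 * ((m + 1 : ℕ) : ℝ) ^ 2)⁻¹ ≤ 2 / h * ((σ + h * m)⁻¹ - (σ + h * (m + 1 : ℕ))⁻¹) := by
        have hD : 0 < σ ^ 2 + h ^ 2 * ((m + 1 : ℕ) : ℝ) ^ 2 := by positivity
        have hR : 2 / h * ((σ + h * m)⁻¹ - (σ + h * (m + 1 : ℕ))⁻¹) =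
            2 / ((σ + h * m) * (σ + h * (m + 1 : ℕ))) := by
          rw [inv_sub_inv hA.ne' hB.ne']
          field_simp
          push_cast
          ring
        rw [hR, inv_eq_one_div, div_le_div_iff₀ hD (mul_pos hA hB)]
        push_cast
        nlinarith [sq_nonneg (σ - h * (2 * m + 1) / 2), sq_nonneg h, mul_pos hh hσ]
      calc _ ≤ (σ ^ 2)⁻¹ + 2 / h * (σ⁻¹ - (σ + h * m)⁻¹) +
            2 / h * ((σ + h * m)⁻¹ - (σ + h * (m + 1 : ℕ))⁻¹) := add_le_add ih hF
        _ = (σ ^ 2)⁻¹ + 2 / h * (σ⁻¹ - (σ + h * (m + 1 : ℕ))⁻¹) := by ring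
  rcases n with _ | m
  · simp only [Finset.range_zero, Finset.sum_empty]; positivity
  · refine (key m).trans ?_
    have hA : 0 < σ + h * m := by positivity
    have : 2 / h * (σ⁻¹ - (σ + h * m)⁻¹) ≤ 2 / (h * σ) := by
      rw [div_mul_eq_mul_div, div_le_div_iff₀ hh (mul_pos hh hσ)]
      have h1 : (σ⁻¹ - (σ + h * ↑m)⁻¹) ≤ σ⁻¹ := by linarith [inv_pos.mpr hA]
      calc 2 * (σ⁻¹ - (σ + h * ↑m)⁻¹) * (h * σ) ≤ 2 * σ⁻¹ * (h * σ) := by gcongr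
        _ = 2 * h := by field_simp
    linarith

/-- The comparison series is summable with sum `≤ σ^{−2} + 2/(hσ)`. [folklore] -/
private theorem tsum_inv_sq_add_le {σ h : ℝ} (hσ : 0 < σ) (hh : 0 < h) :
    Summable (fun j : ℕ ↦ (σ ^ 2 + h ^ 2 * (j : ℝ) ^ 2)⁻¹) ∧
      ∑' j : ℕ, (σ ^ 2 + h ^ 2 * (j : ℝ) ^ 2)⁻¹ ≤ (σ ^ 2)⁻¹ + 2 / (h * σ) := by
  have hs : Summable (fun j : ℕ ↦ (σ ^ 2 + h ^ 2 * (j : ℝ) ^ 2)⁻¹) := by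
    refine summable_of_sum_range_le (c := (σ ^ 2)⁻¹ + 2 / (h * σ)) (fun j ↦ by positivity) fun n ↦ ?_
    exact sum_range_inv_sq_add_le hσ hh n
  exact ⟨hs, Real.tsum_le_of_sum_range_le (fun j ↦ by positivity) fun n ↦ sum_range_inv_sq_add_le hσ hh n⟩

/-- **The sum over the zeros of an Euler factor** [cite: ThornerZaman2017, Lemma 7.3]: for `N ≥ 2` and
`σ = Re s > 0`, `Σ_{n∈ℤ} |s − ω_n|^{−2}` converges and is `≤ 2/σ² + (log N)/σ` (the zeros are spaced by
`2π/log N` on `Re = 0`; TZ: `Σ_{𝔭∣𝔮} Σ_ω ≤ (1/2σ + 2/(σ² log 2)) log N𝔮`). -/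
theorem tsum_norm_inv_sq_sub_eulerNode_le (hN : 2 ≤ N) (c : ℂ) {s : ℂ} (hs : 0 < s.re) :
    Summable (fun n : ℤ ↦ ‖((s - eulerNode N c n) ^ 2)⁻¹‖) ∧
      ∑' n : ℤ, ‖((s - eulerNode N c n) ^ 2)⁻¹‖ ≤ 2 / s.re ^ 2 + Real.log N / s.re := by
  set σ : ℝ := s.re with hσdef
  set lam : ℝ := Real.log (N : ℝ) with hlam
  have hl : 0 < lam := log_pos_of_two_le hN
  set h : ℝ := 2 * π / lam with hhdef
  have hh : 0 < h := by positivity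
  -- `t − Im ω_n = h (u − n)` with `u = (λ t − arg c)/2π`
  set u : ℝ := (lam * s.im - Complex.arg c) / (2 * π) with hu
  have hgap : ∀ n : ℤ, s.im - (eulerNode N c n).im = h * (u - n) := by
    intro n
    rw [eulerNode_im, ← hlam, hhdef, hu]
    field_simp
    ring
  set m : ℤ := ⌊u⌋ with hm
  have hm1 : (m : ℝ) ≤ u := Int.floor_le u
  have hm2 : u < m + 1 := Int.lt_floor_add_one u
  -- the comparison function
  set Fj : ℕ → ℝ := fun j ↦ (σ ^ 2 + h ^ 2 * (j : ℝ) ^ 2)⁻¹ with hFj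
  obtain ⟨hFs, hFle⟩ := tsum_inv_sq_add_le (h := h) hs hh
  -- index of `n`: `j(n) = (n − m − 1)⁺ + (m − n)⁺`
  set jf : ℤ → ℕ := fun n ↦ (n - (m + 1)).toNat + (m - n).toNat with hjf
  have hjbound : ∀ n : ℤ, ((jf n : ℕ) : ℝ) ≤ |u - n| := by
    intro n
    rcases le_or_gt n m with hnm | hnm
    · have h1 : (n - (m + 1)).toNat = 0 := Int.toNat_eq_zero.mpr (by omega)
      have h2 : ((m - n).toNat : ℤ) = m - n := Int.toNat_of_nonneg (by omega)
      have : ((jf n : ℕ) : ℝ) = (m : ℝ) - n := by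
        rw [hjf]; simp only [h1, zero_add]; exact_mod_cast h2
      have hnm' : (n : ℝ) ≤ m := by exact_mod_cast hnm
      rw [this, abs_of_nonneg (by linarith)]
      linarith
    · have h1 : (m - n).toNat = 0 := Int.toNat_eq_zero.mpr (by omega)
      have h2 : ((n - (m + 1)).toNat : ℤ) = n - (m + 1) := Int.toNat_of_nonneg (by omega)
      have : ((jf n : ℕ) : ℝ) = (n : ℝ) - (m + 1) := by
        rw [hjf]; simp only [h1, add_zero]; exact_mod_cast h2
      have hnm' : (m : ℝ) + 1 ≤ n := by exact_mod_cast hnm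
      rw [this, abs_of_nonpos (by linarith)]
      linarith
  -- termwise bound
  have hterm : ∀ n : ℤ, ‖((s - eulerNode N c n) ^ 2)⁻¹‖ ≤ Fj (jf n) := by
    intro n
    have hj0 : (0 : ℝ) ≤ (jf n : ℕ) := Nat.cast_nonneg _
    have hsq : h ^ 2 * ((jf n : ℕ) : ℝ) ^ 2 ≤ (s.im - (eulerNode N c n).im) ^ 2 := by
      rw [hgap n, mul_pow, ← sq_abs (u - n)]
      exact mul_le_mul_of_nonneg_left (pow_le_pow_left₀ hj0 (hjbound n) 2) (sq_nonneg _)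
    have hpos : 0 < σ ^ 2 + h ^ 2 * ((jf n : ℕ) : ℝ) ^ 2 := by positivity
    rw [norm_inv, norm_pow, norm_sq_sub_eulerNode, hFj]
    exact inv_anti₀ hpos (by rw [← hσdef]; linarith)
  -- the dominating family sums to `2 Σ_j F(j)`
  set g : ℤ → ℝ := fun n ↦ Fj (jf n) with hg
  have hgsum : HasSum g (∑' j, Fj j + ∑' j, Fj j) := by
    have e := Equiv.addLeft (m + 1)
    rw [← (Equiv.addLeft (m + 1)).hasSum_iff]
    apply HasSum.of_nat_of_neg_add_one
    · refine hFs.hasSum.congr_fun fun j ↦ ?_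
      simp only [Function.comp_apply, Equiv.coe_addLeft, hg, hjf]
      congr 1
      omega
    · refine hFs.hasSum.congr_fun fun j ↦ ?_
      simp only [Function.comp_apply, Equiv.coe_addLeft, hg, hjf]
      congr 1
      omega
  have hsum : Summable (fun n : ℤ ↦ ‖((s - eulerNode N c n) ^ 2)⁻¹‖) :=
    Summable.of_nonneg_of_le (fun n ↦ norm_nonneg _) hterm hgsum.summable
  refine ⟨hsum, ?_⟩
  calc ∑' n : ℤ, ‖((s - eulerNode N c n) ^ 2)⁻¹‖ ≤ ∑' n : ℤ, g n :=
        hsum.tsum_le_tsum hterm hgsum.summable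
    _ = ∑' j, Fj j + ∑' j, Fj j := hgsum.tsum_eq
    _ ≤ 2 * ((σ ^ 2)⁻¹ + 2 / (h * σ)) := by linarith
    _ = 2 / σ ^ 2 + (2 / π) * (lam / σ) := by
        rw [hhdef]
        have hπ : (π : ℝ) ≠ 0 := Real.pi_ne_zero
        field_simp
    _ ≤ 2 / σ ^ 2 + lam / σ := by
        have h2π : 2 / π ≤ 1 := by rw [div_le_one Real.pi_pos]; exact Real.two_le_pi
        have : 0 ≤ lam / σ := by positivity
        nlinarith
    _ = 2 / s.re ^ 2 + Real.log N / s.re := by rw [hσdef, hlam]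

end sum

end Literature.NumberTheory.LFunctions

end
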